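import Summits.AtomisticToContinuum.HydrodynamicLimit.Theses.RingDensityCertificate

/-!
# `RingDensityCertificate.Assembly` (stmt-AtomisticToContinuum-12133)

The assembly item of route `route-AtomisticToContinuum-RingDensityCertificate`:
`RingSparsity → RingDensityLaw → RingCertificate → ChaosClosure → DiluteSelfConsistency →
_root_.HydrodynamicLimit`.

The proof is pure quantifier bookkeeping, the same composition as the route file's deciding
theorem `Summit.AtomisticToContinuum.HydrodynamicLimit.Theses.RingDensityCertificate.closes`
(which cannot be applied verbatim because it also takes the four support items as hypotheses):
`RingCertificate` applied to `RingSparsity` and `RingDensityLaw` gives `ContactChaos`;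
`ChaosClosure` turns it into the packing-guarded conjunct with some `η₀ > 0`; profile by profile,
the guarded conjunct gives `σ₁` and `DiluteSelfConsistency` at `η := η₀` gives `σ₂` below which
every data-tied classical solution stays in the band `ρ_t(x)σ³ < η₀`; with `σ₀ := min σ₁ σ₂` the
guard is discharged and the conclusion of `_root_.HydrodynamicLimit` follows.

Maintenance note (fullbuild repair 2026-08-17; no mathematics added or changed). The text above describes rev 0 of
the route. The route repair of 2026-08-16T23:42Z–23:52Z (revs 5–7, after the statement re-type D-0032 / p126922 made
the registry conjunct `_root_.HydrodynamicLimit` the PACKING-GUARDED statement) restated the item `Assembly`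
(stmt-12133 → stmt-17871, now the open three-antecedent frame `RingSparsity → RingDensityLaw → ChaosClosure →
_root_.HydrodynamicLimit`) and dropped the shared crux `DiluteSelfConsistency` (stmt-3091) from this route, so the
route file declares neither the rev-0 assembly nor `DiluteSelfConsistency`, and the guard-removal proof below no longer
fits the live `RingDensityCertificate.Assembly` (`intro a₀ …` meets `∃ η₀, …`). The ledger records stmt-12133 as proved
by `Theorems.ringDensityCertificateAssembly_proof` @ 2b7c8b0311b0. For this append-only file to keep elaborating, the
two statements it is about are recorded below under Theorems-local names with their LEDGER SIGNATURES VERBATIM: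
`RingDensityCertificateDiluteSelfConsistencyRev0` (= stmt-3091, this route's dropped copy of the shared crux) and
`RingDensityCertificateAssemblyRev0` (= stmt-12133), the latter's final `_root_.HydrodynamicLimit` rendered as the
declaration that name abbreviated when the item was filed and proved — the unguarded Literature conjecture
`Literature.MathematicalPhysics.KineticTheory.HydrodynamicLimit` (`abbrev HydrodynamicLimit := …` in the registry until
the re-type) — so that the recorded proof keeps BOTH its text and its content (guard removal: guarded conjunct + dilute
self-consistency ⇒ unguarded limit, `σ₀ := min σ₁ σ₂`). The proof carries the new name
`ringDensityCertificate_assembly_rev0_proof`; `ringDensityCertificateAssembly_proof` survives as its deprecated alias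
(append-only: deprecate, don't mutate); `ringDensityCertificate_assembly_rev0_guarded` adds the reading of the same
signature text against today's guarded `_root_.HydrodynamicLimit` (one line weaker: the guard is supplied, so
`DiluteSelfConsistency` idles). Same device as `InformationPercolationEngineAssembly.lean` /
`CollisionIsometryCLTAdaptedWeightCLTStatements.lean`. Nothing is asserted: the records are `Prop` definitions.
-/

namespace Summit.AtomisticToContinuum.HydrodynamicLimit.Theorems

open Summit.AtomisticToContinuum.HydrodynamicLimit.Theses

/-- **Record of this route's dropped copy of the shared crux `DiluteSelfConsistency`** (stmt-AtomisticToContinuum-3091,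
open; dropped from route RingDensityCertificate at rev 7, 2026-08-16T23:52Z, still an item of the sibling routes that
declare it; ledger signature verbatim): for every `η > 0` and all continuous positive profiles there is `σ₀ > 0` such
that for `0 < σ < σ₀` every classical hard-sphere-Euler solution on `[0,T)` whose `t = 0` fields are the LLN limit of
the local Gibbs laws keeps its packing fraction `ρ_t(x)σ³ < η` for all `t < T` and `x`. Recorded here only as an
antecedent of `RingDensityCertificateAssemblyRev0`. A `Prop`, never asserted. -/
def RingDensityCertificateDiluteSelfConsistencyRev0 : Prop :=
  ∀ η : ℝ, 0 < η → ∀ (a₀ θ₀ : Literature.MathematicalPhysics.KineticTheory.T3 → ℝ) (u₀ : Literature.MathematicalPhysics.KineticTheory.T3 → Literature.MathematicalPhysics.KineticTheory.V3), Continuous a₀ → Continuous θ₀ → Continuous u₀ → (∀ x, 0 < a₀ x) → (∀ x, 0 < θ₀ x) → ∃ σ₀ : ℝ, 0 < σ₀ ∧ ∀ σ : ℝ, 0 < σ → σ < σ₀ → ∀ (T : ℝ) (ρ θ : ℝ → Literature.MathematicalPhysics.KineticTheory.T3 → ℝ) (u : ℝ → Literature.MathematicalPhysics.KineticTheory.T3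 → Literature.MathematicalPhysics.KineticTheory.V3), Literature.MathematicalPhysics.KineticTheory.IsHardSphereEulerSolution σ T ρ u θ → ∀ Φ : (N : ℕ) → Literature.Analysis.FluidPDE.HardSphereFlow (Literature.Analysis.FluidPDE.Torus.geometry (Fin 3)) (Literature.MathematicalPhysics.KineticTheory.hsDiameter σ N) (N + 1), Literature.MathematicalPhysics.KineticTheory.TendstoHydroFieldsAt (fun N => Literature.MathematicalPhysics.KineticTheory.localGibbsLaw σ a₀ u₀ θ₀ N (Φ N)) Φ ρ u θ 0 → ∀ t ∈ Set.Ico 0 T, ∀ x, ρ t x * σ ^ 3 < η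

/-- **Record of the assembly item of route RingDensityCertificate, rev 0** (stmt-AtomisticToContinuum-12133; proved as
`Theorems.ringDensityCertificateAssembly_proof` @ 2b7c8b0311b0, then restated as stmt-17871 at rev 5): ledger signature
verbatim, `RingSparsity → RingDensityLaw → RingCertificate → ChaosClosure → DiluteSelfConsistency →
_root_.HydrodynamicLimit`, with `DiluteSelfConsistency` the record above and the final `_root_.HydrodynamicLimit`
rendered as the declaration it abbreviated at the time, the UNGUARDED Literature conjecture
`Literature.MathematicalPhysics.KineticTheory.HydrodynamicLimit` (for all continuous positive profiles there is `σ₀ > 0`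
below which every classical hard-sphere-Euler solution is the in-probability limit of the empirical fields) — the
statement the recorded guard-removal proof proves. A `Prop`, asserted only through
`ringDensityCertificate_assembly_rev0_proof` (pure logic over the four route decls). -/
def RingDensityCertificateAssemblyRev0 : Prop :=
  RingDensityCertificate.RingSparsity → RingDensityCertificate.RingDensityLaw → RingDensityCertificate.RingCertificate →
    RingDensityCertificate.ChaosClosure → RingDensityCertificateDiluteSelfConsistencyRev0 →
      Literature.MathematicalPhysics.KineticTheory.HydrodynamicLimit

/-- **Assembly of route `RingDensityCertificate`, rev 0** (stmt-AtomisticToContinuum-12133): the five rev-0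
route items `RingSparsity`, `RingDensityLaw`, `RingCertificate`, `ChaosClosure`,
`DiluteSelfConsistency` imply the (then unguarded) sub-problem statement `HydrodynamicLimit`
(pure logic: certificate ⇒ contact chaos ⇒ guarded conjunct, guard lifted by
`DiluteSelfConsistency` with `σ₀ := min σ₁ σ₂`). Proof text of the recorded
`ringDensityCertificateAssembly_proof` @ 2b7c8b0311b0, unchanged, against the verbatim record
`RingDensityCertificateAssemblyRev0` (fullbuild repair 2026-08-17). -/
theorem ringDensityCertificate_assembly_rev0_proof : RingDensityCertificateAssemblyRev0 := by
  unfold RingDensityCertificateAssemblyRev0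
  intro hSparse hRing hCert hClose hDilute
  obtain ⟨η₀, hη₀, hBand⟩ := hClose (hCert hSparse hRing)
  intro a₀ θ₀ u₀ ha hθ hu ha0 hθ0
  obtain ⟨σ₁, hσ₁, h₁⟩ := hBand a₀ θ₀ u₀ ha hθ hu ha0 hθ0
  obtain ⟨σ₂, hσ₂, h₂⟩ := hDilute η₀ hη₀ a₀ θ₀ u₀ ha hθ hu ha0 hθ0
  refine ⟨min σ₁ σ₂, lt_min hσ₁ hσ₂, ?_⟩
  intro σ hσ hσlt T ρ θ u hsol Φ h0 t ht
  exact h₁ σ hσ (lt_of_lt_of_le hσlt (min_le_left _ _)) T ρ θ u hsol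
    (fun s hs x => h₂ σ hσ (lt_of_lt_of_le hσlt (min_le_right _ _)) T ρ θ u hsol Φ h0 s hs x)
    Φ h0 t ht

/-- Deprecated spelling of `ringDensityCertificate_assembly_rev0_proof`: the ledger's closing declaration of
stmt-AtomisticToContinuum-12133 read `theorem ringDensityCertificateAssembly_proof : RingDensityCertificate.Assembly`
against the rev-0 item; since route rev 5 that decl name carries the open three-antecedent frame stmt-17871, which this
bookkeeping does not prove, so the name now points at the same proof of the verbatim record of the statement it was
about (append-only: deprecate, don't mutate). -/
@[deprecated ringDensityCertificate_assembly_rev0_proof (since := "2026-08-17")]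
alias ringDensityCertificateAssembly_proof := ringDensityCertificate_assembly_rev0_proof

/-- **The same signature text read against today's registry conjunct.** With `_root_.HydrodynamicLimit` the
packing-guarded statement (re-type p126922), the rev-0 chain `RingSparsity → RingDensityLaw → RingCertificate →
ChaosClosure → DiluteSelfConsistency → _root_.HydrodynamicLimit` holds by one line of logic — `ChaosClosure` applied to
the certificate's `ContactChaos` IS the guarded conjunct verbatim, and `DiluteSelfConsistency` idles (this is the live
route's deciding theorem `RingDensityCertificate.closes` with an unused fifth antecedent). [folklore] -/
theorem ringDensityCertificate_assembly_rev0_guarded :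
    RingDensityCertificate.RingSparsity → RingDensityCertificate.RingDensityLaw → RingDensityCertificate.RingCertificate →
      RingDensityCertificate.ChaosClosure → RingDensityCertificateDiluteSelfConsistencyRev0 → _root_.HydrodynamicLimit :=
  fun hSparse hRing hCert hClose _ => hClose (hCert hSparse hRing)

end Summit.AtomisticToContinuum.HydrodynamicLimit.Theorems
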